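import Summits.PneNP.PneNP.Theorems.SymmetryBudgetNoHiddenOrderBranchSumHub

/-!
# BranchSum III: fresh and stale bad steps; `Σ_{k<N} d k ≤ 6·|V|·Nat.log 2 |V|`

Part C and the conclusion of the proof of CG84-FLATNESS.md Theorem 9.1 (abstract form, §9.3):

* `two_mul_d_lt_of_stale` — DECAY: a step stale w.r.t. an earlier bad step has less than half its
  branching number (the earlier hub cell is still partly alive, by exhaustion);
* `stale_of_stale_of_stale` — CHAINS: two steps stale w.r.t. the same step are stale w.r.t. each other,
  so "latest step I am stale to" is injective;
* `sum_card_fresh_giant_le` — FRESH COUNT: the fresh giants through a vertex halve, so the fresh giants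
  have total size `≤ |V|·Nat.log 2 |V|`, whence `Σ_fresh d ≤ 2·|V|·Nat.log 2 |V|`;
* `sum_d_bad_le` — stale steps are dominated by fresh ones: `Σ_bad d ≤ 4·|V|·Nat.log 2 |V|`;
* `sum_d_le` — **Theorem 9.1**: `Σ_{k<N} d k ≤ 6·|V|·Nat.log 2 |V|` for every `RefinementPath`.

Consequence recorded in the memo (not formalised here): along every root–leaf path of the
Corneil–Goldberg tree with component sections the label disorder is `≤ g(14 + 2 log₂(1+log₂ g))`,
which makes the set-compressed symmetric canonisation of the `⌊log₂ m⌋`-window quasi-polynomial.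
-/

namespace Summit.PneNP.PneNP.Theorems

open Finset

namespace BranchSum

variable {V : Type*} [DecidableEq V] {G : SimpleGraph V} [DecidableRel G.Adj] {N : ℕ}

namespace RefinementPath

variable (R : RefinementPath G N)

/-- `exists_hub` repackaged as `HubSpec`. -/
theorem exists_hubSpec {k : ℕ} (hk : k < N) (hbad : R.Bad k) : ∃ z y, R.HubSpec k z y := by
  obtain ⟨z, hz, y, hy, h1, h2, h3⟩ := R.exists_hub hk hbad
  exact ⟨z, y, hz, hy, h1, h2, h3⟩

/-- The hub cell `Z_k` is part of the progress of step `k`: `|Z_k| ≤ Δ_k`. -/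
theorem card_hubCell_le_delta {k : ℕ} {z y : V} (h : R.HubSpec k z y) :
    (R.cell (k + 1) z).card ≤ R.delta k := by
  obtain ⟨hz, -, hzh, -, -⟩ := h
  refine card_le_card fun t ht => mem_filter.2 ⟨R.nest k (R.cell_subset_W _ _ ht), Or.inr ?_⟩
  have htW : t ∈ R.W (k + 1) := R.cell_subset_W _ _ ht
  have h1 : R.cell (k + 1) t = R.cell (k + 1) z := R.cell_eq_of_mem ht
  have h2 : R.cell k t = R.cell k z :=
    R.cell_eq_of_mem (R.cell_subset_cell_of_le (Nat.le_succ k) hz ht)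
  rw [h1, h2]
  exact hzh

/-- **Decay.** A stale step has less than half the branching number of the step it is stale to. -/
theorem two_mul_d_lt_of_stale {z y : ℕ → V} {k j : ℕ} (hbk : R.Bad k)
    (hhk : R.HubSpec k (z k) (y k)) (hhj : R.HubSpec j (z j) (y j)) (hst : R.Stale y j k) :
    2 * R.d j < R.d k := by
  obtain ⟨hkj, hGG, hcard⟩ := hst
  obtain ⟨hzk, hyk, hzhk, hygk, hadjk⟩ := hhk
  by_cases hgone : ∀ t ∈ R.cell (k + 1) (z k), t ∉ R.W j
  · -- the hub cell of `k` is exhausted by node `j`: contradiction with staleness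
    exfalso
    have hyjW : y j ∈ R.W j := R.nest j hhj.2.1
    have hk1j : k + 1 < j := by
      rcases Nat.lt_or_ge (k + 1) j with h | h
      · exact h
      · have : j = k + 1 := le_antisymm h hkj
        subst this
        exact absurd hzk (hgone (z k) (R.self_mem_cell hzk))
    have hyjG : y j ∈ R.cell (k + 1) (y k) := hGG (R.self_mem_cell hhj.2.1)
    have := R.two_mul_card_cell_le_of_exhausted hzk hyk hzhk hygk hadjk hk1j hgone hyjW hyjG
    omega
  · push Not at hgone
    obtain ⟨t, ht, htj⟩ := hgone
    have h1 : R.d j ≤ (R.cell j t).card := R.d_le j t htj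
    have h2 : (R.cell j t).card ≤ (R.cell (k + 1) t).card := R.card_cell_le_of_le hkj htj
    have h3 : R.cell (k + 1) t = R.cell (k + 1) (z k) := R.cell_eq_of_mem ht
    have h4 := R.card_hubCell_le_delta ⟨hzk, hyk, hzhk, hygk, hadjk⟩
    rw [h3] at h2
    unfold Bad at hbk
    omega

/-- **Chains.** Two steps stale w.r.t. the same earlier step are stale w.r.t. each other. -/
theorem stale_of_stale_of_stale {z y : ℕ → V} {k j₁ j₂ : ℕ} (hj₁₂ : j₁ < j₂)
    (hh₁ : R.HubSpec j₁ (z j₁) (y j₁)) (hh₂ : R.HubSpec j₂ (z j₂) (y j₂))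
    (hs₁ : R.Stale y j₁ k) (hs₂ : R.Stale y j₂ k) : R.Stale y j₂ j₁ := by
  obtain ⟨hkj₁, hG₁, hc₁⟩ := hs₁
  obtain ⟨hkj₂, hG₂, hc₂⟩ := hs₂
  have hy₁W : y j₁ ∈ R.W j₁ := R.nest _ hh₁.2.1
  have hy₂W : y j₂ ∈ R.W j₂ := R.nest _ hh₂.2.1
  have hy₂W₁ : y j₂ ∈ R.W (j₁ + 1) := R.W_subset_of_le (Nat.succ_le_of_lt hj₁₂) hy₂W
  -- the node-`j` cells of both giants lie inside the giant of `k`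
  have hGk₁ : R.cell (k + 1) (y j₁) = R.cell (k + 1) (y k) := R.cell_eq_of_mem (hG₁ (R.self_mem_cell hh₁.2.1))
  have hGk₂ : R.cell (k + 1) (y j₂) = R.cell (k + 1) (y k) := R.cell_eq_of_mem (hG₂ (R.self_mem_cell hh₂.2.1))
  have hC₁ : R.cell j₁ (y j₁) ⊆ R.cell (k + 1) (y k) := hGk₁ ▸ R.cell_subset_cell_of_le hkj₁ hy₁W
  have hC₂ : R.cell j₂ (y j₂) ⊆ R.cell (k + 1) (y k) := hGk₂ ▸ R.cell_subset_cell_of_le hkj₂ hy₂W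
  -- they meet, hence `C' j₂ ⊆ C' j₁`
  have hmeet : ¬ Disjoint (R.cell j₁ (y j₁)) (R.cell j₂ (y j₂)) := by
    intro hdis
    have := card_le_card (union_subset hC₁ hC₂)
    rw [card_union_of_disjoint hdis] at this
    omega
  obtain ⟨w, hw₁, hw₂⟩ : ∃ w ∈ R.cell j₁ (y j₁), w ∈ R.cell j₂ (y j₂) := by
    simpa [not_disjoint_iff] using hmeet
  have hwW₂ : w ∈ R.W j₂ := R.cell_subset_W _ _ hw₂
  have hC₂₁ : R.cell j₂ (y j₂) ⊆ R.cell j₁ (y j₁) := by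
    rw [← R.cell_eq_of_mem hw₂, ← R.cell_eq_of_mem hw₁]
    exact R.cell_subset_cell_of_le hj₁₂.le hwW₂
  -- the node-`(j₁+1)` cell `Q` of `y j₂` inside `C' j₁` is the giant of `j₁`
  have hQC : R.cell (j₁ + 1) (y j₂) ⊆ R.cell j₁ (y j₁) := by
    rw [← R.cell_eq_of_mem (hC₂₁ (R.self_mem_cell hy₂W))]
    exact R.cell_subset_cell_of_le (Nat.le_succ j₁) hy₂W₁
  have hC₂Q : R.cell j₂ (y j₂) ⊆ R.cell (j₁ + 1) (y j₂) := R.cell_subset_cell_of_le (Nat.succ_le_of_lt hj₁₂) hy₂W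
  have hG₁C : R.cell (j₁ + 1) (y j₁) ⊆ R.cell j₁ (y j₁) := R.cell_subset_cell_of_le (Nat.le_succ j₁) hh₁.2.1
  have hG₁k : (R.cell (j₁ + 1) (y j₁)).card ≤ (R.cell (k + 1) (y k)).card := card_le_card hG₁
  have hgiant₁ := hh₁.2.2.2.1
  rcases R.cell_eq_or_disjoint (j₁ + 1) (y j₂) (y j₁) with hQ | hQ
  · refine ⟨hj₁₂, ?_, ?_⟩
    · exact ((R.cell_subset_cell_of_le (Nat.le_succ j₂) hh₂.2.1).trans hC₂Q).trans hQ.subset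
    · omega
  · exfalso
    have h1 := card_le_card (union_subset hQC hG₁C)
    rw [card_union_of_disjoint hQ] at h1
    have h2 := card_le_card hC₂Q
    have h3 := card_le_card hC₁
    omega

section Counting2

variable [Fintype V]

/-- A cardinality as a sum of indicators over all vertices. -/
theorem card_eq_sum_univ_ite (s : Finset V) : s.card = ∑ w, if w ∈ s then 1 else 0 := by
  rw [Finset.sum_ite_mem, univ_inter, card_eq_sum_ones]

/-- **Fresh count.** The giants of the fresh bad steps have total size at most `|V| · Nat.log 2 |V|`:
the fresh giants through a fixed vertex at least halve in size. -/
theorem sum_card_fresh_giant_le {z y : ℕ → V} (hhub : ∀ k, k < N → R.Bad k → R.HubSpec k (z k) (y k)) :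
    ∑ j ∈ (range N).filter (fun j => R.Bad j ∧ ∀ k < j, R.Bad k → ¬ R.Stale y j k),
      (R.cell (j + 1) (y j)).card ≤ Fintype.card V * Nat.log 2 (Fintype.card V) := by
  obtain ⟨Fr, hFr⟩ : ∃ Fr, Fr = (range N).filter (fun j => R.Bad j ∧ ∀ k < j, R.Bad k → ¬ R.Stale y j k) :=
    ⟨_, rfl⟩
  rw [← hFr]
  have hmemFr : ∀ {j}, j ∈ Fr ↔ j < N ∧ R.Bad j ∧ ∀ k < j, R.Bad k → ¬ R.Stale y j k := by
    intro j; rw [hFr]; simp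
  calc ∑ j ∈ Fr, (R.cell (j + 1) (y j)).card
      = ∑ j ∈ Fr, ∑ w, (if w ∈ R.cell (j + 1) (y j) then 1 else 0) :=
        sum_congr rfl fun j _ => card_eq_sum_univ_ite _
    _ = ∑ w, ∑ j ∈ Fr, (if w ∈ R.cell (j + 1) (y j) then 1 else 0) := sum_comm
    _ = ∑ w, (Fr.filter fun j => w ∈ R.cell (j + 1) (y j)).card := by
        refine sum_congr rfl fun w _ => ?_
        conv_rhs => rw [card_eq_sum_ones, sum_filter]
    _ ≤ ∑ _w : V, Nat.log 2 (Fintype.card V) := by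
        refine sum_le_sum fun w _ => card_le_log_of_halving _ (fun j => (R.cell (j + 1) (y j)).card) _ ?_ ?_ ?_
        · intro j hj
          rw [mem_filter] at hj
          obtain ⟨hjN, hbj, -⟩ := hmemFr.1 hj.1
          exact R.two_le (j + 1) (y j) (hhub j hjN hbj).2.1
        · intro j _
          exact card_le_univ _
        · intro j hj j' hj' hlt
          rw [mem_filter] at hj hj'
          obtain ⟨hjN, hbj, -⟩ := hmemFr.1 hj.1
          obtain ⟨hj'N, hbj', hfresh'⟩ := hmemFr.1 hj'.1
          have hyj' := (hhub j' hj'N hbj').2.1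
          have hGG : R.cell (j' + 1) (y j') ⊆ R.cell (j + 1) (y j) := by
            rw [← R.cell_eq_of_mem hj'.2, ← R.cell_eq_of_mem hj.2]
            exact R.cell_subset_cell_of_le (Nat.succ_le_succ hlt.le) (R.cell_subset_W _ _ hj'.2)
          have hns : ¬ R.Stale y j' j := hfresh' j hlt hbj
          have hle : 2 * (R.cell j' (y j')).card ≤ (R.cell (j + 1) (y j)).card := by
            unfold Stale at hns
            push Not at hns
            exact hns hlt hGG
          have hGC : (R.cell (j' + 1) (y j')).card ≤ (R.cell j' (y j')).card :=
            R.card_cell_le_of_le (Nat.le_succ j') hyj'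
          omega
    _ = Fintype.card V * Nat.log 2 (Fintype.card V) := by simp [sum_const, card_univ]

/-- `Σ_{fresh} d ≤ 2 |V| log₂ |V|`. -/
theorem sum_d_fresh_le {z y : ℕ → V} (hhub : ∀ k, k < N → R.Bad k → R.HubSpec k (z k) (y k)) :
    ∑ j ∈ (range N).filter (fun j => R.Bad j ∧ ∀ k < j, R.Bad k → ¬ R.Stale y j k), R.d j ≤
      2 * (Fintype.card V * Nat.log 2 (Fintype.card V)) := by
  calc ∑ j ∈ (range N).filter (fun j => R.Bad j ∧ ∀ k < j, R.Bad k → ¬ R.Stale y j k), R.d j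
      ≤ ∑ j ∈ (range N).filter (fun j => R.Bad j ∧ ∀ k < j, R.Bad k → ¬ R.Stale y j k),
          2 * (R.cell (j + 1) (y j)).card := by
        refine sum_le_sum fun j hj => ?_
        simp only [mem_filter, mem_range] at hj
        obtain ⟨-, hy, -, hyg, -⟩ := hhub j hj.1 hj.2.1
        have h1 : R.d j ≤ (R.cell j (y j)).card := R.d_le j (y j) (R.nest j hy)
        omega
    _ = 2 * _ := by rw [mul_sum]
    _ ≤ 2 * (Fintype.card V * Nat.log 2 (Fintype.card V)) := Nat.mul_le_mul_left 2 (R.sum_card_fresh_giant_le hhub)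

/-- **Stale steps are dominated by fresh ones:** `Σ_{bad} d ≤ 4 |V| log₂ |V|`. -/
theorem sum_d_bad_le {z y : ℕ → V} (hhub : ∀ k, k < N → R.Bad k → R.HubSpec k (z k) (y k)) :
    ∑ j ∈ (range N).filter (fun j => R.Bad j), R.d j ≤ 4 * (Fintype.card V * Nat.log 2 (Fintype.card V)) := by
  -- split the bad steps into fresh and non-fresh ones
  have hsplit : ∑ j ∈ ((range N).filter fun j => R.Bad j).filter
        (fun j => ∀ k < j, R.Bad k → ¬ R.Stale y j k), R.d j +
      ∑ j ∈ ((range N).filter fun j => R.Bad j).filter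
        (fun j => ¬ ∀ k < j, R.Bad k → ¬ R.Stale y j k), R.d j =
      ∑ j ∈ (range N).filter (fun j => R.Bad j), R.d j := sum_filter_add_sum_filter_not _ _ _
  have hFr : ((range N).filter fun j => R.Bad j).filter (fun j => ∀ k < j, R.Bad k → ¬ R.Stale y j k) =
      (range N).filter (fun j => R.Bad j ∧ ∀ k < j, R.Bad k → ¬ R.Stale y j k) := filter_filter _ _ _
  rw [hFr] at hsplit
  have hfresh := R.sum_d_fresh_le hhub
  -- the non-fresh bad steps, made opaque
  obtain ⟨NF, hNF⟩ : ∃ NF, NF = ((range N).filter fun j => R.Bad j).filter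
      (fun j => ¬ ∀ k < j, R.Bad k → ¬ R.Stale y j k) := ⟨_, rfl⟩
  rw [← hNF] at hsplit
  have hmemNF : ∀ {j}, j ∈ NF → j < N ∧ R.Bad j ∧ ∃ k < j, R.Bad k ∧ R.Stale y j k := by
    intro j hj
    rw [hNF] at hj
    simp only [mem_filter, mem_range] at hj
    push Not at hj
    exact ⟨hj.1.1, hj.1.2, hj.2⟩
  -- the parent of a non-fresh bad step: the latest bad step it is stale to
  have hpar : ∀ j ∈ NF, ((range j).filter fun k => R.Bad k ∧ R.Stale y j k).Nonempty := by
    intro j hj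
    obtain ⟨-, -, k, hkj, hbk, hst⟩ := hmemNF hj
    exact ⟨k, by simp [hkj, hbk, hst]⟩
  obtain ⟨p, hp⟩ : ∃ p : ℕ → ℕ, ∀ j ∈ NF, p j < j ∧ R.Bad (p j) ∧ R.Stale y j (p j) ∧
      ∀ k < j, R.Bad k → R.Stale y j k → k ≤ p j := by
    classical
    refine ⟨fun j => if h : ((range j).filter fun k => R.Bad k ∧ R.Stale y j k).Nonempty then
      ((range j).filter fun k => R.Bad k ∧ R.Stale y j k).max' h else 0, fun j hj => ?_⟩
    have hne := hpar j hj
    simp only [dif_pos hne]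
    have hmem := ((range j).filter fun k => R.Bad k ∧ R.Stale y j k).max'_mem hne
    simp only [mem_filter, mem_range] at hmem
    exact ⟨hmem.1, hmem.2.1, hmem.2.2, fun k hk hbk hst => le_max' _ _ (by simp [hk, hbk, hst])⟩
  -- `p` is injective on the non-fresh bad steps
  have hinj : Set.InjOn p ↑NF := by
    have main : ∀ {a b}, a ∈ NF → b ∈ NF → p a = p b → a < b → False := by
      intro a b ha hb hab hlt
      obtain ⟨-, -, hsa, -⟩ := hp a ha
      obtain ⟨-, -, hsb, hmaxb⟩ := hp b hb
      obtain ⟨haN, hba, -⟩ := hmemNF ha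
      obtain ⟨hbN, hbb, -⟩ := hmemNF hb
      have hst : R.Stale y b a :=
        R.stale_of_stale_of_stale hlt (hhub a haN hba) (hhub b hbN hbb) hsa (hab ▸ hsb)
      have h1 := hmaxb a hlt hba hst
      have h2 := (hp a ha).1
      omega
    intro j₁ hj₁ j₂ hj₂ hpeq
    by_contra hne
    rcases lt_or_gt_of_ne hne with h | h
    · exact main hj₁ hj₂ hpeq h
    · exact main hj₂ hj₁ hpeq.symm h
  -- decay along `p`, summed, and re-indexed through the injection
  have hdecay : 2 * ∑ j ∈ NF, R.d j ≤ ∑ j ∈ NF, R.d (p j) := by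
    rw [mul_sum]
    refine sum_le_sum fun j hj => ?_
    obtain ⟨hpj, hbp, hst, -⟩ := hp j hj
    obtain ⟨hjN, hbj, -⟩ := hmemNF hj
    have hpN : p j < N := hpj.trans hjN
    exact (R.two_mul_d_lt_of_stale hbp (hhub _ hpN hbp) (hhub j hjN hbj) hst).le
  have himage : ∑ j ∈ NF, R.d (p j) = ∑ k ∈ NF.image p, R.d k := (sum_image hinj).symm
  have hsub : NF.image p ⊆ (range N).filter (fun j => R.Bad j) := by
    intro k hk
    rw [mem_image] at hk
    obtain ⟨j, hj, rfl⟩ := hk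
    obtain ⟨hpj, hbp, -, -⟩ := hp j hj
    exact mem_filter.2 ⟨mem_range.2 (hpj.trans (hmemNF hj).1), hbp⟩
  have h3 : ∑ k ∈ NF.image p, R.d k ≤ ∑ k ∈ (range N).filter (fun j => R.Bad j), R.d k :=
    sum_le_sum_of_subset_of_nonneg hsub fun _ _ _ => Nat.zero_le _
  omega

/-- **Theorem 9.1 (BranchSum), abstract form.** Along a refinement path the branching numbers sum to
at most `6 · |V| · Nat.log 2 |V|`. -/
theorem sum_d_le (R : RefinementPath G N) :
    ∑ k ∈ range N, R.d k ≤ 6 * (Fintype.card V * Nat.log 2 (Fintype.card V)) := by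
  classical
  rcases isEmpty_or_nonempty V with hV | hV
  · -- no vertices: there is no transition at all
    have hN : N = 0 := by
      by_contra h
      obtain ⟨x, -, -⟩ := R.exists_removed (Nat.pos_of_ne_zero h)
      exact hV.elim x
    subst hN
    simp
  · obtain ⟨v₀⟩ := hV
    have hex : ∀ k, ∃ z y : V, k < N → R.Bad k → R.HubSpec k z y := by
      intro k
      by_cases h : k < N ∧ R.Bad k
      · obtain ⟨z, y, hzy⟩ := R.exists_hubSpec h.1 h.2
        exact ⟨z, y, fun _ _ => hzy⟩
      · exact ⟨v₀, v₀, fun hk hb => absurd ⟨hk, hb⟩ h⟩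
    choose z y hhub using hex
    have hsplit := sum_filter_add_sum_filter_not (range N) (fun k => R.Bad k) (fun k => R.d k)
    have h1 := R.sum_good_le
    have h2 := R.sum_d_bad_le hhub
    omega

end Counting2

/-- **Progress dichotomy (U3, CG84-FLATNESS §8.2 / §9.1 (2)).** After a BAD step `k < N` (progress
`2·Δ_k < d_k`) the next branching number is less than half of the current one: `2 · d (k+1) < d k`
(the hub cell of node `k+1` is a cell of at most `Δ_k` elements).  Equivalently: every step with
`d k ≤ 2 · d (k+1)` — in particular every STAIRCASE step of the Corneil–Goldberg process — is good. -/
theorem two_mul_d_succ_lt_of_bad {k : ℕ} (hk : k < N) (hbad : R.Bad k) : 2 * R.d (k + 1) < R.d k := by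
  obtain ⟨z, y, hhub⟩ := R.exists_hubSpec hk hbad
  have h1 : R.d (k + 1) ≤ (R.cell (k + 1) z).card := R.d_le (k + 1) z hhub.1
  have h2 := R.card_hubCell_le_delta hhub
  unfold Bad at hbad
  omega

/-- Contrapositive of `two_mul_d_succ_lt_of_bad`: a step whose successor keeps at least half the
branching number makes progress `d k ≤ 2 · Δ_k`. -/
theorem d_le_two_mul_delta_of_le {k : ℕ} (hk : k < N) (h : R.d k ≤ 2 * R.d (k + 1)) :
    R.d k ≤ 2 * R.delta k := by
  by_contra hlt
  have hbad : R.Bad k := by unfold Bad; omega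
  have := R.two_mul_d_succ_lt_of_bad hk hbad
  omega


end RefinementPath

end BranchSum

end Summit.PneNP.PneNP.Theorems
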